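/-
Copyright (c) 2026 the pub-hodgecm-mathlib formalisation cell (harness21).  Prover seat hodgecm-mathlib-LH4-p10 (g9) (valve hand), Track B «K2-LIT»,
#184♮ = hLiu418 = `stmt-HodgeConjecture-24832`; socket #41, KIND W, (KW-arch-hBL) letter (L7-height) for the (3c) assembler (KW desk F0P2-p08 (g4) DEAL (B)
2026-09-05T01:40:05Z; architect K2E3-p11 (g10) WORD #1 (L7); assembler K2Liu-p11 (g5) (L3)).  A corollary of ★ K2Liu-p08 (g2) G7-C
`K2LiuIwasawaHeightLatticeSumBound.detFactor_le_height`.  THEOREMS ONLY (no `def`, no `instance`, no notation, no named-fact hypothesis, no `sorry`).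
-/
import Summits.HodgeConjecture.HodgeConjecture.Theorems.K2LiuIwasawaHeightLatticeSumBound   -- ★ G7-C `detFactor_le_height`, `re_det_mul_conjTranspose`, `exists_adelicHeightGL_floor` (+ ★ G7-B)
import HarnessLib

/-!
# Crux `HLiu418`, socket #41, KIND W, (L7-height): THE TWO-SIDED HEIGHT LETTER OF THE IWASAWA LEVI BLOCKS — `∏_σ ‖det y_σ‖^{±1} ≤ Ch·‖h‖^{ah}`

Cell `hodgecm-mathlib`, crux item hLiu418 = `stmt-HodgeConjecture-24832` (helper lane `--supports … --as helper`, count-neutral); KW line, valve hand LH4-p10 (g9).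
THE LETTER (assembler K2Liu-p11 (g5)'s (L3), the input `hP h1 h2 hCh hah` of ★ `K2LiuKindWArchBlockGrowthConversion.rpow_le_of_two_sided_height`): in the GENERIC unitary frame
`(F, E, c, N, J)`, for complex places `w σ` fixed by `c ≠ 1`, a block size `p` with `r : p ⊕ p ≃ Fin N`, frames `T σ, T σ⁻¹` and movers `κ σ, κ′ σ` with entries `≤ M` — BY VALUE —
and ANY block decomposition `hdec : T σ · (h_∞)~_{w σ} · T σ⁻¹ = [y σ, b σ; 0, d σ] · κ σ` (★ p863724's `hBL` Iwasawa reading, :176–181):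
  `∃ Ch ah, 1 ≤ Ch ∧ 0 ≤ ah ∧ ∀ h y b d κ κ′, … → hdec → 0 < ∏_σ ‖det y_σ‖ ∧ ∏_σ ‖det y_σ‖ ≤ Ch·‖h‖^{ah} ∧ (∏_σ ‖det y_σ‖)⁻¹ ≤ Ch·‖h‖^{ah}`
(`‖h‖ = adelicHeightGL N E (adelicVal F E c N J h)`, the Borel–Jacquet height; `adelicVal … h = ↑h` is `rfl`).
THE PROOF is bookkeeping on ★ G7-C: `detFactor_le_height` gives `∏_σ (Re det(y_σ y_σᴴ))^{−A} ≤ C_A·‖h‖^{A′_A}` for EVERY real `A`; `Re det(y yᴴ) = ‖det y‖²`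
(★ `re_det_mul_conjTranspose`), so `A = −½` and `A = ½` are the two sides; the two pairs `(C_A, A′_A)` are merged into ONE `(Ch, ah)` with the height floor
★ `exists_adelicHeightGL_floor` (`0 < c₀ ≤ ‖h‖`, hence `‖h‖^{A′} ≤ c₀^{A′−ah}·‖h‖^{ah}` for `A′ ≤ ah` — `‖h‖ ≥ 1` is not needed and not claimed).
* §1 `rpow_le_floor_mul_rpow` — the merge inequality;  `prod_norm_det_pos`, `sq_rpow_half`, `sq_rpow_neg_half` — bookkeeping.
* §2 **`hHt_of_frame`** — THE HEAD (binders = ★ `detFactor_le_height`'s VERBATIM minus `A`).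
References: [BorelJacquet1979, §1.2, §4.1]; [MoeglinWaldspurger1995, I.2.2, II.1.5]; [Shimura1997, §A3].
HONEST LABEL.  Count-neutral helper, no new analytic content: `HC_CM` is proved only modulo the 7 printed citations (2 remaining named inputs: hLiu418 =
`stmt-HodgeConjecture-24832`, h413 = `stmt-HodgeConjecture-24833`) until rung 0 closes.
-/

set_option autoImplicit false
set_option linter.dupNamespace false -- the mandated namespace repeats `HodgeConjecture.HodgeConjecture`

noncomputable section

open scoped BigOperators ComplexOrder Matrix
-- `Classical` is needed to see the Mathlib normed-ring instances on `mixedSpace E` (note H5 of `AdelicGLnGlue`)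
open scoped Classical
open Finset

namespace Summit.HodgeConjecture.HodgeConjecture.Cruxes.HLiu418.K2LiuKindWArchFrameHeightLetter

open Summit.HodgeConjecture.HodgeConjecture.Cruxes.HLiu418.K2LiuIwasawaHeightLatticeSumBound (detFactor_le_height re_det_mul_conjTranspose
  exists_adelicHeightGL_floor)

/-! ## §1 Bookkeeping -/

/-- **merging height powers with a floor**: `0 < c₀ ≤ H`, `A ≤ a`, `0 ≤ C` ⇒ `C·H^A ≤ (C·c₀^{A−a})·H^a` (`H^{A−a} ≤ c₀^{A−a}` as `A − a ≤ 0`). [folklore] -/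
theorem rpow_le_floor_mul_rpow {c₀ H C A a : ℝ} (hc₀ : 0 < c₀) (hH : c₀ ≤ H) (hA : A ≤ a) (hC : 0 ≤ C) :
    C * H ^ A ≤ C * c₀ ^ (A - a) * H ^ a := by
  have hH0 : 0 < H := lt_of_lt_of_le hc₀ hH
  have hsplit : H ^ A = H ^ (A - a) * H ^ a := by
    rw [← Real.rpow_add hH0]; congr 1; ring
  have hle : H ^ (A - a) ≤ c₀ ^ (A - a) := Real.rpow_le_rpow_of_nonpos hc₀ hH (sub_nonpos.2 hA)
  rw [hsplit, ← mul_assoc]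
  exact mul_le_mul_of_nonneg_right (mul_le_mul_of_nonneg_left hle hC) (Real.rpow_nonneg hH0.le _)

/-- `(‖z‖²)^{½} = ‖z‖`. [folklore] -/
theorem sq_rpow_half (z : ℂ) : (‖z‖ ^ 2) ^ (-(-(1 / 2 : ℝ))) = ‖z‖ := by
  rw [neg_neg, ← Real.sqrt_eq_rpow, Real.sqrt_sq (norm_nonneg z)]

/-- `(‖z‖²)^{−½} = ‖z‖⁻¹`. [folklore] -/
theorem sq_rpow_neg_half (z : ℂ) : (‖z‖ ^ 2) ^ (-(1 / 2 : ℝ)) = ‖z‖⁻¹ := by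
  rw [Real.rpow_neg (sq_nonneg _), ← Real.sqrt_eq_rpow, Real.sqrt_sq (norm_nonneg z)]

/-! ## §2 The two-sided height letter -/

open NumberField NumberField.InfinitePlace IsDedekindDomain
open Literature.NumberTheory.Automorphic Literature.NumberTheory.Automorphic.UnitaryGroup

variable (F E : Type) [Field F] [NumberField F] [Field E] [NumberField E] [Algebra F E] (c : E ≃ₐ[F] E) (N : ℕ) (J : Matrix (Fin N) (Fin N) E)
variable {S p : Type*} [Fintype S] [Fintype p] [DecidableEq p]

/-- **THE TWO-SIDED HEIGHT LETTER `hHt`** (assembler (3c)'s (L3)∕(L7)).  Frame data BY VALUE exactly as ★ G7-C `detFactor_le_height`: complex places `w σ` fixed by `c ≠ 1`,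
`r : p ⊕ p ≃ Fin N` (`N ≥ 1`), frames `T σ, T σ⁻¹` and movers with entries `≤ M` (`1 ≤ M`).  CONCLUSION: ONE pair `(Ch, ah)`, `1 ≤ Ch`, `0 ≤ ah`, such that for every `h` and
every block decomposition `hdec : T σ · (h_∞)~_{w σ} · T σ⁻¹ = [y σ, b σ; 0, d σ] · κ σ`:
`0 < ∏_σ ‖det y_σ‖`, `∏_σ ‖det y_σ‖ ≤ Ch·‖h‖^{ah}` and `(∏_σ ‖det y_σ‖)⁻¹ ≤ Ch·‖h‖^{ah}` — ★ `detFactor_le_height` at `A = −½` and `A = ½` (`Re det(y yᴴ) = ‖det y‖²`), the two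
constant pairs merged with the height floor ★ `exists_adelicHeightGL_floor`. [cite: BorelJacquet1979, §1.2, §4.1] [cite: MoeglinWaldspurger1995, I.2.2] -/
theorem hHt_of_frame [NeZero N] (hc : c ≠ 1) (w : S → {w : InfinitePlace E // IsComplex w}) (hw : ∀ σ, c • (w σ).1 = (w σ).1)
    (r : p ⊕ p ≃ Fin N) (T Tinv : S → Matrix (p ⊕ p) (p ⊕ p) ℂ) (hT : ∀ σ, T σ * Tinv σ = 1) (hT' : ∀ σ, Tinv σ * T σ = 1)
    {M : ℝ} (hM : 1 ≤ M) (hTe : ∀ σ i j, ‖T σ i j‖ ≤ M) (hTe' : ∀ σ i j, ‖Tinv σ i j‖ ≤ M) :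
    ∃ Ch ah : ℝ, 1 ≤ Ch ∧ 0 ≤ ah ∧ ∀ (h : (adelicGroupData F E c N J).Adelic) (y b d : S → Matrix p p ℂ) (κ κ' : S → Matrix (p ⊕ p) (p ⊕ p) ℂ),
      (∀ σ, κ σ * κ' σ = 1) → (∀ σ, κ' σ * κ σ = 1) → (∀ σ i j, ‖κ σ i j‖ ≤ M) → (∀ σ i j, ‖κ' σ i j‖ ≤ M) →
      (∀ σ, T σ * Matrix.reindex r.symm r.symm
          ((((archAt F E c N J (w σ) (hw σ) hc (archPart F E c N J h) : archLocal E N J (w σ)) : GL (Fin N) ℂ) : Matrix (Fin N) (Fin N) ℂ)) *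
          Tinv σ = Matrix.fromBlocks (y σ) (b σ) 0 (d σ) * κ σ) →
      0 < ∏ σ, ‖(y σ).det‖ ∧
      (∏ σ, ‖(y σ).det‖) ≤ Ch * adelicHeightGL N E (adelicVal F E c N J h) ^ ah ∧
      (∏ σ, ‖(y σ).det‖)⁻¹ ≤ Ch * adelicHeightGL N E (adelicVal F E c N J h) ^ ah := by
  obtain ⟨c₀, hc₀, hfloor⟩ := exists_adelicHeightGL_floor E N
  -- ★ G7-C at `A = −½` (the product itself) and `A = ½` (its inverse)
  obtain ⟨C₁, A₁, hC₁, h₁⟩ := detFactor_le_height F E c N J hc w hw r T Tinv hT hT' hM hTe hTe' (-(1 / 2 : ℝ))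
  obtain ⟨C₂, A₂, hC₂, h₂⟩ := detFactor_le_height F E c N J hc w hw r T Tinv hT hT' hM hTe hTe' (1 / 2 : ℝ)
  set ah : ℝ := max 0 (max A₁ A₂) with hah
  set Ch : ℝ := max 1 (max (C₁ * c₀ ^ (A₁ - ah)) (C₂ * c₀ ^ (A₂ - ah))) with hCh
  have hA₁ : A₁ ≤ ah := (le_max_left _ _).trans (le_max_right _ _)
  have hA₂ : A₂ ≤ ah := (le_max_right _ _).trans (le_max_right _ _)
  refine ⟨Ch, ah, le_max_left _ _, le_max_left _ _, fun h y b d κ κ' hκ hκ' hκe hκe' hdec => ?_⟩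
  set H : ℝ := adelicHeightGL N E (adelicVal F E c N J h) with hHdef
  have hcH : c₀ ≤ H := hfloor _
  have hH0 : 0 < H := lt_of_lt_of_le hc₀ hcH
  have hle₁ := h₁ h y b d κ κ' hκ hκ' hκe hκe' hdec
  have hle₂ := h₂ h y b d κ κ' hκ hκ' hκe hκe' hdec
  simp only [re_det_mul_conjTranspose, sq_rpow_half, sq_rpow_neg_half, Finset.prod_inv_distrib] at hle₁ hle₂
  -- `hle₁ : ∏ ‖det y‖ ≤ C₁ H^{A₁}`, `hle₂ : (∏ ‖det y‖)⁻¹ ≤ C₂ H^{A₂}`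
  have hpos : 0 < ∏ σ, ‖(y σ).det‖ := by
    refine Finset.prod_pos fun σ _ => norm_pos_iff.2 fun h0 => ?_
    -- `y σ` is invertible: `[y b; 0 d]·κ` is a unit (it is `T·g̃·T⁻¹` with all three invertible), so `det (y σ) ≠ 0`
    have hunit : IsUnit (Matrix.fromBlocks (y σ) (b σ) 0 (d σ) * κ σ) := by
      rw [← hdec σ]
      refine ((Matrix.isUnit_iff_isUnit_det _).2 ?_)
      rw [Matrix.det_mul, Matrix.det_mul]
      refine (IsUnit.mul (IsUnit.mul ?_ ?_) ?_)
      · exact Matrix.isUnit_det_of_right_inverse (hT σ)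
      · rw [Matrix.det_reindex_self]
        exact (Matrix.isUnits_det_units _)
      · exact Matrix.isUnit_det_of_left_inverse (hT σ)
    have hunit' : IsUnit (Matrix.fromBlocks (y σ) (b σ) 0 (d σ)) := by
      have hκu : IsUnit (κ σ) := (Matrix.isUnit_iff_isUnit_det _).2 (Matrix.isUnit_det_of_right_inverse (hκ σ))
      exact (Units.isUnit_mul_units _ hκu.unit).1 (by simpa using hunit)
    have hy : IsUnit (y σ) := (Matrix.isUnit_fromBlocks_zero₂₁.1 hunit').1
    exact ((Matrix.isUnit_iff_isUnit_det _).1 hy).ne_zero h0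
  refine ⟨hpos, ?_, ?_⟩
  · calc ∏ σ, ‖(y σ).det‖ ≤ C₁ * H ^ A₁ := hle₁
      _ ≤ C₁ * c₀ ^ (A₁ - ah) * H ^ ah := rpow_le_floor_mul_rpow hc₀ hcH hA₁ hC₁
      _ ≤ Ch * H ^ ah := mul_le_mul_of_nonneg_right ((le_max_left _ _).trans (le_max_right _ _)) (Real.rpow_nonneg hH0.le _)
  · calc (∏ σ, ‖(y σ).det‖)⁻¹ ≤ C₂ * H ^ A₂ := hle₂
      _ ≤ C₂ * c₀ ^ (A₂ - ah) * H ^ ah := rpow_le_floor_mul_rpow hc₀ hcH hA₂ hC₂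
      _ ≤ Ch * H ^ ah := mul_le_mul_of_nonneg_right ((le_max_right _ _).trans (le_max_right _ _)) (Real.rpow_nonneg hH0.le _)

end Summit.HodgeConjecture.HodgeConjecture.Cruxes.HLiu418.K2LiuKindWArchFrameHeightLetter

end
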